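import Summits.QuantumFields.YangMills.Theorems.LuscherReductionDressedRitzPolyakovLiftShadowQuasimode
import HarnessLib

/-!
# Crux `DressedRitz` (stmt-QuantumFields-20205), line «polyakovlift» r5, stub S-PSCAL `stub_pscaling` (lane W1-A):
# the UNDRESSED quasimode estimate suffices — `ShadowQuasimodeAt k → DressedShadowQuasimodeAt k → ShadowBudgetAt k → PScalingExistsAt k`

Support module (stub worker ym-20205-polyakovlift-w1a g0; `--supports stmt-QuantumFields-20205`, helper, no closure claim).  Companion of
`…PolyakovLiftShadowQuasimode.lean`: the dressing `K_B^[L]` of the shadow insertion `v_i = ins_{e₀}(g_i ∘ powLink L)` neither helps nor harms a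
quasimode bound at the scale `O(Λ²/L)μ₀` — it costs the constant `2e^{2(E+3)}` (`E` = ONE's uniform level constant of the first `k+1` levels):

* `dressedClause_of_quasimode` — one vector, any lattice size: with `θ = e^{−(E+3)λ_b}λ₀` (`λ₀/2 ≤ e^{−Eλ_b}λ₀ ≤ μ`, `3λ_b ≤ 1`, `Ct ≤ λ_b/8`,
  `Ct ≤ 1/32`, family dominating at `Λd ≤ λ₀/8`): `e^{−(E+3)λ_b·2m}·‖(K_β − a)K_β^[m]x‖² ≤ 2(Ctλ₀)²‖K_β^[m]x‖²`
  (`ShadowQM.dressed_quasimode_of_quasimode`; `a − θ ≥ λ_bλ₀/4`);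
* ★★ `dressedShadowQuasimode_of_shadowQuasimode : ShadowQuasimodeAt k → DressedShadowQuasimodeAt k` (constant `2e^{E+3}(C+1)`, `lam0` lowered to
  `≤ 1/(16(C+1))`, `L0` raised; `m = dressSteps L = L`, `λ_b = Λ/L`, so `e^{−(E+3)λ_b·2L} = e^{−2(E+3)Λ} ≥ e^{−2(E+3)}`);
* ★★★ `shadowBudgetAt_of_shadowQuasimode`, `pscalingExistsAt_of_shadowQuasimode`, `shadowQuasimodeAt_zero`.

WHAT REMAINS for S-PSCAL: `ShadowQuasimodeAt k` (`k ≥ 1`) — one-site semiclassics in two couplings.  HONEST FRAMING: fixed-lattice spectral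
bookkeeping + the closed crux ONE on the conditional femto rung R2b1; `stub_pscaling` stays OPEN; no mass-gap ∕ continuum ∕ Clay claim follows.
References: T. Kato, J. Phys. Soc. Japan 4 (1949) 334 [cite: Kato1949, §1]; M. Lüscher, NPB 219 (1983) 233 [cite: Luscher1983, §3].
-/

set_option autoImplicit false

noncomputable section

open MeasureTheory Filter Topology Real Finset
open Literature.MathematicalPhysics.QuantumFieldTheory (GaugeConfig Site gaugeTransform)
open scoped BigOperators

namespace Summit.QuantumFields.YangMills.Theorems.FemtoTransferGap.PolyakovLift

open Summit.QuantumFields.YangMills.Theorems.FemtoTransferGap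
open Summit.QuantumFields.YangMills.Theorems.FemtoTransferGap.LiftLeak
open Summit.QuantumFields.YangMills.Theorems.FemtoTransferGap.VacDict
open Summit.QuantumFields.YangMills.Theorems.FemtoTransferGap.ShadowQM

/-! ## §1 One vector: the dressed residual from the undressed one -/

section Clause

variable {M : ℕ} [NeZero M]

/-- ★ **Dressed residual from the undressed quasimode bound** (one vector, any lattice size).  `ψ` an exact physical `l2`-orthonormal eigenfamily
dominating at `Λd ≤ λ₀/8`; `e^{−Eλb}λ₀ ≤ μ`, `λ₀/2 ≤ e^{−Eλb}λ₀`, `0 < λb`, `3λb ≤ 1`; `|a − μ| ≤ Ctλ₀`, `Ct ≤ 1/32`, `Ct ≤ λb/8`;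
`‖(K_β − a)x‖² ≤ (Ctλ₀)²‖x‖²`.  Then `e^{−(E+3)λb}^{2m}·‖(K_β − a)K_β^[m]x‖² ≤ 2(Ctλ₀)²‖K_β^[m]x‖²`. [cite: Kato1949, §1] -/
theorem dressedClause_of_quasimode {β : ℝ} (hβ : 0 ≤ β) {N : ℕ} {ψ : Fin N → (GaugeConfig 3 M SU2 → ℝ)} (hψ : ∀ j, IsPhys (ψ j))
    (hon : ∀ i l, l2 (ψ i) (ψ l) = if i = l then 1 else 0) (ev : Fin N → ℝ) (heig : ∀ j, transferApply β (ψ j) = ev j • ψ j)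
    {Λd : ℝ} (hdom : ∀ φ : GaugeConfig 3 M SU2 → ℝ, IsPhys φ → (∀ j, l2 φ (ψ j) = 0) → l2 φ (transferApply β φ) ≤ Λd * l2 φ φ)
    (hΛd : Λd ≤ levelValue su2Rep M β 0 / 8) (hm0 : 0 < levelValue su2Rep M β 0) {C t E lb : ℝ} (hC : 0 ≤ C) (ht0 : 0 ≤ t)
    (hCt : C * t ≤ 1 / 32) (hCtl : C * t ≤ lb / 8) (hlb : 0 < lb) (hlb3 : 3 * lb ≤ 1) {x : GaugeConfig 3 M SU2 → ℝ} (hx : IsPhys x)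
    {a μ : ℝ} (hμlow : Real.exp (-(E * lb)) * levelValue su2Rep M β 0 ≤ μ)
    (hEhalf : levelValue su2Rep M β 0 / 2 ≤ Real.exp (-(E * lb)) * levelValue su2Rep M β 0)
    (haμ : |a - μ| ≤ C * t * levelValue su2Rep M β 0)
    (hq : l2 (transferApply β x - a • x) (transferApply β x - a • x) ≤ (C * t * levelValue su2Rep M β 0) ^ 2 * l2 x x) (m : ℕ) :
    Real.exp (-((E + 3) * lb)) ^ (2 * m) *
        l2 (transferApply β ((transferApply β)^[m] x) - a • (transferApply β)^[m] x)
          (transferApply β ((transferApply β)^[m] x) - a • (transferApply β)^[m] x) ≤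
      2 * (C * t * levelValue su2Rep M β 0) ^ 2 * l2 ((transferApply β)^[m] x) ((transferApply β)^[m] x) := by
  set m0 := levelValue su2Rep M β 0 with hm0def
  set η2 := (C * t * m0) ^ 2 with hη2
  set θ := Real.exp (-((E + 3) * lb)) * m0 with hθdef
  set R := l2 (transferApply β ((transferApply β)^[m] x) - a • (transferApply β)^[m] x)
    (transferApply β ((transferApply β)^[m] x) - a • (transferApply β)^[m] x) with hR
  set W := l2 ((transferApply β)^[m] x) ((transferApply β)^[m] x) with hW
  have hη2nn : 0 ≤ η2 := sq_nonneg _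
  have hCtm : C * t * m0 ≤ m0 / 32 := by have := mul_le_mul_of_nonneg_right hCt hm0.le; linarith
  have ha_lb : 15 * m0 / 32 ≤ a := by have h1 := (abs_le.mp haμ).1; linarith
  have hΛa : Λd < a := by linarith
  -- `θ = e^{−Eλb}·e^{−3λb}·λ₀` and `a − θ ≥ λbλ₀/4`
  have hθ0 : 0 ≤ θ := mul_nonneg (Real.exp_pos _).le hm0.le
  have hsplit : Real.exp (-((E + 3) * lb)) = Real.exp (-(E * lb)) * Real.exp (-(3 * lb)) := by
    rw [← Real.exp_add]; congr 1; ring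
  have h3 : 3 * lb / 2 ≤ 1 - Real.exp (-(3 * lb)) :=
    Literature.NumberTheory.LFunctions.PrimeReciprocal.half_le_one_sub_exp_neg (by linarith) hlb3
  have hgapθ : lb * m0 / 4 ≤ a - θ := by
    -- `a − θ ≥ (e^{−Eλb}λ₀ − Ctλ₀) − e^{−Eλb}e^{−3λb}λ₀ = e^{−Eλb}λ₀(1 − e^{−3λb}) − Ctλ₀ ≥ (λ₀/2)(3λb/2) − λbλ₀/8`
    have h1 : Real.exp (-(E * lb)) * m0 - C * t * m0 ≤ a := by have := (abs_le.mp haμ).1; linarith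
    have h2 : θ = Real.exp (-(E * lb)) * m0 * Real.exp (-(3 * lb)) := by rw [hθdef, hsplit]; ring
    have h4 : Real.exp (-(E * lb)) * m0 * (3 * lb / 2) ≤ Real.exp (-(E * lb)) * m0 * (1 - Real.exp (-(3 * lb))) :=
      mul_le_mul_of_nonneg_left h3 (mul_nonneg (Real.exp_pos _).le hm0.le)
    have h5 : m0 / 2 * (3 * lb / 2) ≤ Real.exp (-(E * lb)) * m0 * (3 * lb / 2) :=
      mul_le_mul_of_nonneg_right hEhalf (by linarith)
    have h6 : C * t * m0 ≤ lb / 8 * m0 := mul_le_mul_of_nonneg_right hCtl hm0.le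
    rw [h2]; nlinarith
  have hθa : θ < a := by
    have : 0 < lb * m0 / 4 := by positivity
    linarith
  -- the two leakage ratios are `≤ 1/4`
  have hr1 : η2 / (a - Λd) ^ 2 ≤ 1 / 4 := by
    have hgap : m0 / 4 ≤ a - Λd := by linarith
    have hgap2 : (m0 / 4) ^ 2 ≤ (a - Λd) ^ 2 := pow_le_pow_left₀ (by positivity) hgap 2
    rw [div_le_iff₀ (lt_of_lt_of_le (by positivity) hgap2)]
    have : η2 ≤ (m0 / 32) ^ 2 := by
      rw [hη2]; exact pow_le_pow_left₀ (by positivity) hCtm 2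
    nlinarith
  have hr2 : η2 / (a - θ) ^ 2 ≤ 1 / 4 := by
    have hpos : 0 < lb * m0 / 4 := by positivity
    have hgap2 : (lb * m0 / 4) ^ 2 ≤ (a - θ) ^ 2 := pow_le_pow_left₀ hpos.le hgapθ 2
    rw [div_le_iff₀ (lt_of_lt_of_le (by positivity) hgap2)]
    have h6 : C * t * m0 ≤ lb * m0 / 8 := by have := mul_le_mul_of_nonneg_right hCtl hm0.le; linarith
    have : η2 ≤ (lb * m0 / 8) ^ 2 := by rw [hη2]; exact pow_le_pow_left₀ (by positivity) h6 2
    nlinarith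
  have hδ : 1 / 2 ≤ 1 - η2 / (a - Λd) ^ 2 - η2 / (a - θ) ^ 2 := by linarith
  -- the generic dressing lemma
  have hmain := dressed_quasimode_of_quasimode hβ hψ hon ev heig hΛa hθ0 hθa hη2nn hdom hx m hq
  have hθpow : θ ^ (2 * m) = Real.exp (-((E + 3) * lb)) ^ (2 * m) * m0 ^ (2 * m) := by rw [hθdef, mul_pow]
  have hm0pow : 0 < m0 ^ (2 * m) := pow_pos hm0 _
  have hepos : 0 ≤ Real.exp (-((E + 3) * lb)) ^ (2 * m) := pow_nonneg (Real.exp_pos _).le _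
  have hR0 : 0 ≤ R := l2_self_nonneg _
  -- `e^{2m} m0^{2m} (1/2) R ≤ θ^{2m} δ R ≤ m0^{2m} η2 W`
  have h1 : Real.exp (-((E + 3) * lb)) ^ (2 * m) * m0 ^ (2 * m) * (1 / 2) * R ≤ m0 ^ (2 * m) * η2 * W := by
    calc Real.exp (-((E + 3) * lb)) ^ (2 * m) * m0 ^ (2 * m) * (1 / 2) * R
        ≤ Real.exp (-((E + 3) * lb)) ^ (2 * m) * m0 ^ (2 * m) * (1 - η2 / (a - Λd) ^ 2 - η2 / (a - θ) ^ 2) * R :=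
          mul_le_mul_of_nonneg_right (mul_le_mul_of_nonneg_left hδ (mul_nonneg hepos hm0pow.le)) hR0
      _ = θ ^ (2 * m) * (1 - η2 / (a - Λd) ^ 2 - η2 / (a - θ) ^ 2) * R := by rw [hθpow]
      _ ≤ m0 ^ (2 * m) * η2 * W := hmain
  have h2 : Real.exp (-((E + 3) * lb)) ^ (2 * m) * (1 / 2) * R ≤ η2 * W := by
    have h1' : m0 ^ (2 * m) * (Real.exp (-((E + 3) * lb)) ^ (2 * m) * (1 / 2) * R) ≤ m0 ^ (2 * m) * (η2 * W) := by
      calc _ = Real.exp (-((E + 3) * lb)) ^ (2 * m) * m0 ^ (2 * m) * (1 / 2) * R := by ring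
        _ ≤ m0 ^ (2 * m) * η2 * W := h1
        _ = m0 ^ (2 * m) * (η2 * W) := by ring
    exact le_of_mul_le_mul_left h1' hm0pow
  linarith

end Clause

/-! ## §2 ★★ `ShadowQuasimodeAt k → DressedShadowQuasimodeAt k` -/

/-- ★★ **The undressed quasimode estimate suffices**: `ShadowQuasimodeAt k → DressedShadowQuasimodeAt k` (constant `2e^{E+3}(C+1)`, `lam0`
lowered to `min lam0 (1/(16(C+1)))`, `L0` raised). [cite: Kato1949, §1] [cite: Luscher1983, §3] -/
theorem dressedShadowQuasimode_of_shadowQuasimode {k : ℕ} (h : ShadowQuasimodeAt k) : DressedShadowQuasimodeAt k := by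
  classical
  obtain ⟨C, lam0, hC, hlam0, hk⟩ := h
  obtain ⟨E, B0, hE, hB0, hONE⟩ := exists_uniform_level_lower k
  set C' : ℝ := 2 * Real.exp (E + 3) * (C + 1) with hC'
  have hC'0 : 0 ≤ C' := by positivity
  have hlam0' : 0 < min lam0 (1 / (16 * (C + 1))) := lt_min hlam0 (by positivity)
  refine ⟨C', min lam0 (1 / (16 * (C + 1))), hC'0, hlam0', fun lam hlam hle => ?_⟩
  obtain ⟨L0, hL⟩ := hk lam hlam (hle.trans (min_le_left _ _))
  have hlamC : lam ≤ 1 / (16 * (C + 1)) := hle.trans (min_le_right _ _)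
  set R0 : ℝ := 4 * lam ^ 3 * B0 + 4 * E * lam + 128 * C * lam ^ 2 + 6 * lam + 1 with hR0
  refine ⟨max L0 ⌈R0⌉₊, fun L hL0 Λ hlo hhi e₀ he₀ => ?_⟩
  have hLR : R0 ≤ (L : ℝ) := (Nat.le_ceil R0).trans (by exact_mod_cast (le_max_right _ _).trans hL0)
  have hl3 : 0 ≤ 4 * lam ^ 3 * B0 := by positivity
  have hl1 : 0 ≤ 4 * E * lam := by positivity
  have hl2 : 0 ≤ 128 * C * lam ^ 2 := by positivity
  have hLr1 : (1 : ℝ) ≤ L := by linarith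
  have hLpos : 0 < L := Nat.cast_pos.mp (zero_lt_one.trans_le hLr1)
  have hLr : (0 : ℝ) < L := Nat.cast_pos.mpr hLpos
  have hΛ : 0 < Λ := hlam.trans_le hlo
  obtain ⟨ω, g, hbasis, hq⟩ := hL L ((le_max_left _ _).trans hL0) Λ hlo hhi e₀ he₀
  have hBpos : 0 < 2 * (L : ℝ) ^ 3 / Λ ^ 3 := div_pos (mul_pos two_pos (pow_pos hLr 3)) (pow_pos hΛ 3)
  set B : ℝ := 2 * (L : ℝ) ^ 3 / Λ ^ 3 with hBdef
  set m0 := levelValue su2Rep 1 B 0 with hm0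
  set t : ℝ := Λ ^ 2 / L with ht
  set lb : ℝ := Λ / L with hlbdef
  have hm0pos : 0 < m0 := levelValue_su2Rep_pos (L := 1) hBpos 0
  have ht0 : 0 ≤ t := div_nonneg (sq_nonneg _) hLr.le
  have hlbpos : 0 < lb := div_pos hΛ hLr
  have htlb : t = Λ * lb := by rw [ht, hlbdef]; ring
  have hg : ∀ i, IsPhys (g i) := hbasis.2.2.2.2.1
  have hv : ∀ i, IsPhys (OpPlat.ins e₀ (g i ∘ powLink L)) := fun i => OpPlat.isPhys_ins he₀.1 (isPhys_comp_powLink L (hg i))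
  -- smallness: `CΛ ≤ 1/8`, `Ct ≤ 1/32`, `Ct ≤ λb/8`, `3λb ≤ 1`, `Λ ≤ 1`
  have hCΛ : C * Λ ≤ 1 / 8 := by
    have h1 : C * Λ ≤ C * (2 * (1 / (16 * (C + 1)))) := mul_le_mul_of_nonneg_left (hhi.trans (by linarith)) hC
    have h2 : C * (2 * (1 / (16 * (C + 1)))) = (C / (C + 1)) / 8 := by field_simp; ring
    have h3 : C / (C + 1) ≤ 1 := by rw [div_le_one (by linarith)]; linarith
    linarith
  have hΛ1 : Λ ≤ 1 := by
    have h16 : (1 : ℝ) / (16 * (C + 1)) ≤ 1 / 16 := one_div_le_one_div_of_le (by norm_num) (by linarith)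
    linarith
  have hCtl : C * t ≤ lb / 8 := by
    rw [htlb, ← mul_assoc]; linarith [mul_le_mul_of_nonneg_right hCΛ hlbpos.le]
  have hCt : C * t ≤ 1 / 32 := by
    have h1 : Λ ^ 2 ≤ 4 * lam ^ 2 := by
      have := pow_le_pow_left₀ hΛ.le hhi 2; rw [mul_pow] at this; norm_num at this; linarith
    have h2 : C * t ≤ C * (4 * lam ^ 2) / L := by
      rw [ht, ← mul_div_assoc]; exact div_le_div_of_nonneg_right (mul_le_mul_of_nonneg_left h1 hC) hLr.le
    have h3 : C * (4 * lam ^ 2) / L ≤ 1 / 32 := by rw [div_le_iff₀ hLr]; linarith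
    exact h2.trans h3
  have hΛL : Λ ≤ L := by linarith
  have hlb3 : 3 * lb ≤ 1 := by
    rw [hlbdef, ← mul_div_assoc, div_le_one hLr]; linarith
  -- ONE at `B`
  have hlbB : bareLambda B = lb := bareLambda_scaled hΛ hLpos
  have hlb1 : bareLambda B ≤ 1 := by rw [hlbB, hlbdef, div_le_one hLr]; exact hΛL
  have hBge : B0 ≤ B := by
    have h1 : Λ ^ 3 ≤ 8 * lam ^ 3 := by
      have := pow_le_pow_left₀ hΛ.le hhi 3; rw [mul_pow] at this; norm_num at this; linarith
    have h2 : (L : ℝ) ≤ (L : ℝ) ^ 3 := le_self_pow₀ hLr1 (by norm_num)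
    have h3 : 4 * lam ^ 3 * B0 ≤ L := by linarith
    rw [hBdef, le_div_iff₀ (pow_pos hΛ 3)]
    linarith [mul_le_mul_of_nonneg_left h1 hB0]
  have hElb : E * lb ≤ 1 / 2 := by
    rw [hlbdef]
    have h1 : E * (Λ / L) ≤ E * (2 * lam) / L := by
      rw [← mul_div_assoc]; exact div_le_div_of_nonneg_right (mul_le_mul_of_nonneg_left hhi hE) hLr.le
    have h2 : E * (2 * lam) / L ≤ 1 / 2 := by rw [div_le_iff₀ hLr]; linarith
    exact h1.trans h2
  have hEhalf : m0 / 2 ≤ Real.exp (-(E * lb)) * m0 := by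
    have h2 : 1 / 2 ≤ Real.exp (-(E * lb)) := by have := Real.add_one_le_exp (-(E * lb)); linarith
    calc m0 / 2 = 1 / 2 * m0 := by ring
      _ ≤ Real.exp (-(E * lb)) * m0 := mul_le_mul_of_nonneg_right h2 hm0pos.le
  have hμlow : ∀ j : ℕ, j ≤ k → Real.exp (-(E * lb)) * m0 ≤ levelValue su2Rep 1 B j := fun j hj => by
    have := hONE B hBpos hBge hlb1 j hj; rwa [hlbB] at this
  -- the dominating family
  obtain ⟨N, hN⟩ : ∃ N : ℕ, levelValue su2Rep 1 B N ≤ m0 / 8 := by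
    have hev := (tendsto_levelValue_atTop_zero (L := 1) hBpos).eventually (Iic_mem_nhds (show (0 : ℝ) < m0 / 8 by positivity))
    exact hev.exists
  obtain ⟨ψ, hψ, hon, heig0, hdom⟩ := exists_eigenfamily_dominating (L := 1) hBpos N
  obtain ⟨ev, hev⟩ : ∃ ev : Fin N → ℝ, ∀ j, ev j = levelValue su2Rep 1 B j := ⟨_, fun j => rfl⟩
  have heig : ∀ j, transferApply B (ψ j) = ev j • ψ j := fun j => by rw [hev]; exact heig0 j
  -- the dressing factor `e^{−(E+3)λb·2L} = e^{−2(E+3)Λ} ≥ e^{−2(E+3)}`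
  have hfac : Real.exp (-(2 * (E + 3))) ≤ Real.exp (-((E + 3) * lb)) ^ (2 * dressSteps L) := by
    rw [← Real.exp_nat_mul]
    apply Real.exp_le_exp.mpr
    have hds : ((2 * dressSteps L : ℕ) : ℝ) = 2 * (L : ℝ) := by simp [dressSteps]
    rw [hds, hlbdef]
    have : 2 * (L : ℝ) * -((E + 3) * (Λ / L)) = -(2 * (E + 3) * Λ) := by field_simp
    rw [this]
    have hE3 : 0 ≤ 2 * (E + 3) := by positivity
    linarith [mul_le_mul_of_nonneg_left hΛ1 hE3]
  refine ⟨ω, g, hbasis, fun i => ?_⟩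
  obtain ⟨a, ha1, ha2⟩ := hq i
  have hμi := hμlow ((i : ℕ) + 1) (by have := i.2; omega)
  refine ⟨a, ha1.trans ?_, ?_⟩
  · -- `C ≤ C'`
    have hCC' : C ≤ C' := by
      have he : 1 ≤ Real.exp (E + 3) := Real.one_le_exp (by positivity)
      have := mul_le_mul_of_nonneg_right he (by linarith : (0 : ℝ) ≤ C + 1)
      rw [hC']; linarith
    exact mul_le_mul_of_nonneg_right (mul_le_mul_of_nonneg_right hCC' ht0) hm0pos.le
  · have hcl := dressedClause_of_quasimode hBpos.le hψ hon ev heig hdom hN hm0pos hC ht0 hCt hCtl hlbpos hlb3 (hv i) hμi hEhalf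
      ha1 ha2 (dressSteps L)
    -- `shadowFamily B L e₀ g i = K_B^[dressSteps L] v_i`
    show l2 (transferApply B ((transferApply B)^[dressSteps L] (OpPlat.ins e₀ (g i ∘ powLink L))) -
          a • (transferApply B)^[dressSteps L] (OpPlat.ins e₀ (g i ∘ powLink L)))
        (transferApply B ((transferApply B)^[dressSteps L] (OpPlat.ins e₀ (g i ∘ powLink L))) -
          a • (transferApply B)^[dressSteps L] (OpPlat.ins e₀ (g i ∘ powLink L))) ≤
      (C' * t * m0) ^ 2 * l2 ((transferApply B)^[dressSteps L] (OpPlat.ins e₀ (g i ∘ powLink L)))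
        ((transferApply B)^[dressSteps L] (OpPlat.ins e₀ (g i ∘ powLink L)))
    set R := l2 (transferApply B ((transferApply B)^[dressSteps L] (OpPlat.ins e₀ (g i ∘ powLink L))) -
          a • (transferApply B)^[dressSteps L] (OpPlat.ins e₀ (g i ∘ powLink L)))
        (transferApply B ((transferApply B)^[dressSteps L] (OpPlat.ins e₀ (g i ∘ powLink L))) -
          a • (transferApply B)^[dressSteps L] (OpPlat.ins e₀ (g i ∘ powLink L))) with hR
    set W := l2 ((transferApply B)^[dressSteps L] (OpPlat.ins e₀ (g i ∘ powLink L)))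
        ((transferApply B)^[dressSteps L] (OpPlat.ins e₀ (g i ∘ powLink L))) with hW
    have hR0 : 0 ≤ R := l2_self_nonneg _
    have hW0 : 0 ≤ W := l2_self_nonneg _
    -- `e^{−2(E+3)} R ≤ 2 (Ctm0)² W`, and `(C't m0)² = 4e^{2(E+3)}(C+1)² (t m0)² ≥ 2e^{2(E+3)} (C t m0)²`
    have h1 : Real.exp (-(2 * (E + 3))) * R ≤ 2 * (C * t * m0) ^ 2 * W :=
      (mul_le_mul_of_nonneg_right hfac hR0).trans hcl
    have hee : Real.exp (-(2 * (E + 3))) * Real.exp (E + 3) ^ 2 = 1 := by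
      rw [← Real.exp_nat_mul, ← Real.exp_add]; norm_num
    have h2 : 2 * (C * t * m0) ^ 2 * W ≤ Real.exp (-(2 * (E + 3))) * ((C' * t * m0) ^ 2 * W) := by
      have hsq : 2 * (C * t * m0) ^ 2 ≤ Real.exp (-(2 * (E + 3))) * (C' * t * m0) ^ 2 := by
        have e1 : Real.exp (-(2 * (E + 3))) * (C' * t * m0) ^ 2 =
            4 * (Real.exp (-(2 * (E + 3))) * Real.exp (E + 3) ^ 2) * ((C + 1) * t * m0) ^ 2 := by rw [hC']; ring
        rw [e1, hee]
        have : (C * t * m0) ^ 2 ≤ ((C + 1) * t * m0) ^ 2 :=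
          pow_le_pow_left₀ (by positivity) (by linarith [mul_nonneg ht0 hm0pos.le]) 2
        linarith [sq_nonneg (C * t * m0)]
      calc 2 * (C * t * m0) ^ 2 * W ≤ Real.exp (-(2 * (E + 3))) * (C' * t * m0) ^ 2 * W := mul_le_mul_of_nonneg_right hsq hW0
        _ = _ := by ring
    exact le_of_mul_le_mul_left (h1.trans h2) (Real.exp_pos _)

/-! ## §3 ★★★ The chain to `ShadowBudgetAt` and `PScalingExistsAt`; `k = 0` -/

/-- ★★★ `ShadowQuasimodeAt k → ShadowBudgetAt k`. [cite: Kato1949, §1] [cite: Luscher1983, §3] -/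
theorem shadowBudgetAt_of_shadowQuasimode {k : ℕ} (h : ShadowQuasimodeAt k) : ShadowBudgetAt k :=
  shadowBudgetAt_of_dressedShadowQuasimode (dressedShadowQuasimode_of_shadowQuasimode h)

/-- ★★★ `ShadowQuasimodeAt k → PScalingExistsAt k` (the registered stub's `k`-th conjunct from the one-site quasimode estimate). [cite: Luscher1983, §3] -/
theorem pscalingExistsAt_of_shadowQuasimode {k : ℕ} (h : ShadowQuasimodeAt k) : PScalingExistsAt k :=
  pscalingExistsAt_of_shadowBudget (shadowBudgetAt_of_shadowQuasimode h)

/-- `k = 0`: `ShadowQuasimodeAt 0` (vacuous; `exists_liftBasis`). [folklore] -/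
theorem shadowQuasimodeAt_zero : ShadowQuasimodeAt 0 := by
  refine ⟨0, 1, le_rfl, one_pos, fun lam hlam _ => ⟨0, fun L _ Λ hlo _ e₀ _ => ?_⟩⟩
  have hΛ : 0 < Λ := hlam.trans_le hlo
  obtain ⟨ω, g, hb⟩ := exists_liftBasis (B := 2 / Λ ^ 3) (div_pos two_pos (pow_pos hΛ 3)) 0
  exact ⟨ω, g, hb, fun i => i.elim0⟩

end Summit.QuantumFields.YangMills.Theorems.FemtoTransferGap.PolyakovLift

end
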